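import Literature.AlgebraicGeometry.Morphisms.CechH1Projective
import Literature.AlgebraicGeometry.Motives.SegreEmbedding
import HarnessLib

/-!
# `Ȟ¹(𝒰, 𝒪_Z)` is finitely generated for closed subschemes `Z ⊆ 𝐏^r_A` over a Noetherian ring

Conclusion of `Literature/AlgebraicGeometry/Morphisms/CechH1Projective`: for a closed immersion
`ι : Z ↪ 𝐏^r_A` over a Noetherian ring `A` and the cover `𝒰 = (Z_i = Z ∩ D₊(x_i))_{i ≤ r}`,

* `ProjCech.compH1 ι : CechH1 (Z → Spec A) 𝒰 →ₗ[A] ker d¹ / im d⁰` — the comparison map from the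
  tree's Čech `H¹` of the structure sheaf (`Literature/AlgebraicGeometry/Morphisms/CechH1`: all ordered
  pairs `(i, j)`) to the cohomology of the alternating complex `ProjCech.cechZ` (strictly increasing pairs):
  restrict `c_{ab}` (`a < b`) to `Z_{ab}`; cocycles go to cocycles (`dQ_edgeVal_eq_zero`) and
  coboundaries to coboundaries (`edgeVal_cechD0`);
* `ProjCech.compH1_injective` — it is **injective** (the ordered and alternating Čech complexes agree in
  `H¹`, Stacks Project, Tag 01FG/01FM in degree one): an all-pairs cocycle has `c_{ii} = 0`
  (`cocycle_diag`) and `c_{ij} = -c_{ji}` (`cocycle_antisymm`), and restriction along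
  `Z_a ∩ Z_b = Z_{ab}` is injective;
* `ProjCech.moduleFinite_cechH1` — **`Ȟ¹(𝒰, 𝒪_Z)` is a finitely generated `A`-module** (Hartshorne,
  *Algebraic Geometry*, III Thm. 5.2 (a) for `𝓕 = 𝒪_Z`, `i = 1`, with `H¹` computed by the Čech complex of
  the standard affine cover, III Thm. 4.5), from `ProjCech.moduleFinite_homology_cechZ` (Serre's
  finiteness theorem, `Literature/Algebra/Homology/SerreFiniteness`) and the injectivity;
* `ProjCech.isAffineOpen_cover`, `ProjCech.iSup_cover_eq_top` — the `Z_i` are affine and cover `Z`, so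
  this is exactly the hypothesis `hfin` of
  `Literature.AlgebraicGeometry.Morphisms.hasSurjectiveFormalFunctions_of_finite_cechH1` (the theorem on
  formal functions for `H⁰` from the finiteness of `Ȟ¹`) for projective schemes over `A`.

Everything is proved; no named facts. This discharges, for PROJECTIVE `X → Spec A`, the content of the
named fact `Literature.AlgebraicGeometry.Morphisms.cechH1_finite` (stated there for proper `X`; the proper
case needs Chow's lemma in addition). Mathlib searched (pin v4.32): `ShortComplex.moduleCatHomologyIso`,
`HomologicalComplex.homologyIsoSc'`, `Submodule.mapQ`, `Module.Finite.of_injective`,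
`Proj.iSup_basicOpen_eq_top` (used); no Čech cohomology of schemes in Mathlib.

## References

* R. Hartshorne, *Algebraic Geometry*, GTM 52, Springer (1977): III Thm. 4.5, III Thm. 5.2 (a) (p. 228,
  PDF p. 284). [Hartshorne1977]
* The Stacks Project, Tags 01FG, 01FM (ordered/alternating Čech complexes), 01XD. [StacksProject]
-/

noncomputable section

open CategoryTheory AlgebraicGeometry TopologicalSpace Opposite
open Literature.Algebra.Homology Literature.Algebra.Homology.LaurentCech Literature.Algebra.Homology.OrderedCech

universe u

attribute [local instance] MvPolynomial.gradedAlgebra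
  Literature.AlgebraicGeometry.Motives.ProjBaseChange.algebraBase

namespace Literature.AlgebraicGeometry.Morphisms

namespace ProjCech

variable {A : Type u} [CommRing A] {r : ℕ} {Z : Scheme.{u}} (ι : Z ⟶ PP A r)

/-! ### Small simplices -/

/-- A `2`-simplex is `{a < b < e}`. [folklore] -/
theorem exists_eq_triple (σ : Simplex (Fin (r + 1)) 2) :
    ∃ a b e : Fin (r + 1), a < b ∧ b < e ∧ σ.1 = {a, b, e} := by
  obtain ⟨x, y, z, hxy, hxz, hyz, hs⟩ := Finset.card_eq_three.mp (by have := σ.2.2; omega : σ.1.card = 3)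
  -- sort the three elements
  have key : ∀ x y z : Fin (r + 1), x < y → x < z → y ≠ z →
      ∃ a b e : Fin (r + 1), a < b ∧ b < e ∧ ({x, y, z} : Finset (Fin (r + 1))) = {a, b, e} := by
    intro x y z hxy hxz hyz
    rcases lt_or_gt_of_ne hyz with h | h
    · exact ⟨x, y, z, hxy, h, rfl⟩
    · refine ⟨x, z, y, hxz, h, ?_⟩
      ext i; simp only [Finset.mem_insert, Finset.mem_singleton]; tauto
  rcases lt_trichotomy x y with h₁ | h₁ | h₁
  · rcases lt_trichotomy x z with h₂ | h₂ | h₂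
    · obtain ⟨a, b, e, hab, hbe, h⟩ := key x y z h₁ h₂ hyz
      exact ⟨a, b, e, hab, hbe, hs.trans h⟩
    · exact absurd h₂ hxz
    · -- `z < x < y`
      refine ⟨z, x, y, h₂, h₁, hs.trans ?_⟩
      ext i; simp only [Finset.mem_insert, Finset.mem_singleton]; tauto
  · exact absurd h₁ hxy
  · rcases lt_trichotomy y z with h₂ | h₂ | h₂
    · obtain ⟨a, b, e, hab, hbe, h⟩ := key y x z h₁ h₂ hxz
      refine ⟨a, b, e, hab, hbe, hs.trans (Eq.trans ?_ h)⟩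
      ext i; simp only [Finset.mem_insert, Finset.mem_singleton]; tauto
    · exact absurd h₂ hyz
    · -- `z < y < x`
      refine ⟨z, y, x, h₂, h₁, hs.trans ?_⟩
      ext i; simp only [Finset.mem_insert, Finset.mem_singleton]; tauto

/-- The triangle `{a, b, e}` (`a < b < e`) as a `2`-simplex. [folklore] -/
def triangle (a b e : Fin (r + 1)) (hab : a < b) (hbe : b < e) : Simplex (Fin (r + 1)) 2 :=
  ⟨{a, b, e}, Finset.insert_nonempty a _, by
    rw [Finset.card_insert_of_notMem, Finset.card_pair hbe.ne]
    · norm_num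
    · simp only [Finset.mem_insert, Finset.mem_singleton, not_or]
      exact ⟨hab.ne, (hab.trans hbe).ne⟩⟩

/-- Every `2`-simplex is a triangle. [folklore] -/
theorem exists_eq_triangle (σ : Simplex (Fin (r + 1)) 2) :
    ∃ a b e, ∃ (hab : a < b) (hbe : b < e), σ = triangle a b e hab hbe := by
  obtain ⟨a, b, e, hab, hbe, h⟩ := exists_eq_triple σ
  exact ⟨a, b, e, hab, hbe, Subtype.ext h⟩

section Signs

variable {a b e : Fin (r + 1)} (hab : a < b) (hbe : b < e)
include hab hbe

/-- The faces of a triangle. [folklore] -/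
theorem triangle_erase_left : ({a, b, e} : Finset (Fin (r + 1))).erase a = {b, e} := by
  ext i; simp only [Finset.mem_erase, Finset.mem_insert, Finset.mem_singleton]
  constructor
  · rintro ⟨h1, h2 | h2 | h2⟩ <;> simp_all
  · rintro (rfl | rfl)
    · exact ⟨hab.ne', Or.inr (Or.inl rfl)⟩
    · exact ⟨(hab.trans hbe).ne', Or.inr (Or.inr rfl)⟩

/-- See `triangle_erase_left`. [folklore] -/
theorem triangle_erase_mid : ({a, b, e} : Finset (Fin (r + 1))).erase b = {a, e} := by
  ext i; simp only [Finset.mem_erase, Finset.mem_insert, Finset.mem_singleton]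
  constructor
  · rintro ⟨h1, h2 | h2 | h2⟩ <;> simp_all
  · rintro (rfl | rfl)
    · exact ⟨hab.ne, Or.inl rfl⟩
    · exact ⟨hbe.ne', Or.inr (Or.inr rfl)⟩

/-- See `triangle_erase_left`. [folklore] -/
theorem triangle_erase_right : ({a, b, e} : Finset (Fin (r + 1))).erase e = {a, b} := by
  ext i; simp only [Finset.mem_erase, Finset.mem_insert, Finset.mem_singleton]
  constructor
  · rintro ⟨h1, h2 | h2 | h2⟩ <;> simp_all
  · rintro (rfl | rfl)
    · exact ⟨(hab.trans hbe).ne, Or.inl rfl⟩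
    · exact ⟨hbe.ne, Or.inr (Or.inl rfl)⟩

/-- The signs of a triangle: `ε = 1, -1, 1`. [folklore] -/
theorem sign_triangle_left : sign A ({a, b, e} : Finset (Fin (r + 1))) a = 1 := by
  rw [sign, show ({a, b, e} : Finset (Fin (r + 1))).filter (· < a) = ∅ by
    ext i; simp only [Finset.mem_filter, Finset.mem_insert, Finset.mem_singleton, Finset.notMem_empty,
      iff_false, not_and]
    rintro (rfl | rfl | rfl)
    · exact lt_irrefl _
    · exact lt_asymm hab
    · exact lt_asymm (hab.trans hbe)]
  simp

/-- See `sign_triangle_left`. [folklore] -/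
theorem sign_triangle_mid : sign A ({a, b, e} : Finset (Fin (r + 1))) b = -1 := by
  rw [sign, show ({a, b, e} : Finset (Fin (r + 1))).filter (· < b) = {a} by
    ext i; simp only [Finset.mem_filter, Finset.mem_insert, Finset.mem_singleton]
    constructor
    · rintro ⟨rfl | rfl | rfl, h⟩
      · rfl
      · exact absurd h (lt_irrefl _)
      · exact absurd h (lt_asymm hbe)
    · rintro rfl; exact ⟨Or.inl rfl, hab⟩]
  simp

/-- See `sign_triangle_left`. [folklore] -/
theorem sign_triangle_right : sign A ({a, b, e} : Finset (Fin (r + 1))) e = 1 := by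
  rw [sign, show ({a, b, e} : Finset (Fin (r + 1))).filter (· < e) = {a, b} by
    ext i; simp only [Finset.mem_filter, Finset.mem_insert, Finset.mem_singleton]
    constructor
    · rintro ⟨rfl | rfl | rfl, h⟩
      · exact Or.inl rfl
      · exact Or.inr rfl
      · exact absurd h (lt_irrefl _)
    · rintro (rfl | rfl)
      · exact ⟨Or.inl rfl, hab.trans hbe⟩
      · exact ⟨Or.inr (Or.inl rfl), hbe⟩, Finset.card_pair hab.ne]
  norm_num

end Signs

/-! ### Transport lemmas for values of cochains -/

/-- Restricting the values of a cochain at equal simplices gives the same section. [folklore] -/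
theorem res_apply_eq_of_eq {p : ℤ} (q : QX ι p) {E E' : Simplex (Fin (r + 1)) p} (e : E = E')
    {V : Z.Opens} (h : V ≤ Zop ι E.1) (h' : V ≤ Zop ι E'.1) :
    Sections.res (strZ ι) h (q E) = Sections.res (strZ ι) h' (q E') := by
  subst e; rfl

/-- `faceQ` at a face identified with a given simplex `E`. [folklore] -/
theorem faceQ_eq {p : ℤ} (τ : Simplex (Fin (r + 1)) (p + 1)) (x : Fin (r + 1)) (E : Simplex (Fin (r + 1)) p)
    (hE : τ.1.erase x = E.1) (hle : Zop ι τ.1 ≤ Zop ι E.1) (q : QX ι p) :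
    faceQ ι p τ x q = Sections.res (strZ ι) hle (q E) := by
  have h : (τ.1.erase x).Nonempty ∧ ((τ.1.erase x).card : ℤ) = p + 1 := by rw [hE]; exact E.2
  rw [faceQ_apply_of ι τ x h]
  exact res_apply_eq_of_eq ι q (E := ⟨τ.1.erase x, h⟩) (E' := E) (Subtype.ext hE) _ _

/-- **`dQ` on an edge**: `(d g)_{a<b} = g_b|_{Z_{ab}} - g_a|_{Z_{ab}}`. [folklore] -/
theorem dQ_edge (g : QX ι 0) (a b : Fin (r + 1)) (hab : a < b) :
    dQ ι 0 g (edge a b hab) =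
      Sections.res (strZ ι) (Zop_mono ι (by simp)) (g (vertex b)) -
        Sections.res (strZ ι) (Zop_mono ι (by simp)) (g (vertex a)) := by
  rw [dQ_apply]
  change ∑ x ∈ ({a, b} : Finset (Fin (r + 1))), sign A {a, b} x • faceQ ι 0 (edge a b hab) x g = _
  rw [Finset.sum_pair hab.ne]
  have h1 : ({a, b} : Finset (Fin (r + 1))).erase a = (vertex b).1 := by
    rw [vertex_val, Finset.erase_insert]; simp [hab.ne]
  have h2 : ({a, b} : Finset (Fin (r + 1))).erase b = (vertex a).1 := by
    rw [vertex_val, Finset.pair_comm, Finset.erase_insert]; simp [hab.ne']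
  have s1 : sign A ({a, b} : Finset (Fin (r + 1))) a = 1 := by
    rw [sign, show ({a, b} : Finset (Fin (r + 1))).filter (· < a) = ∅ by
      ext i; simp only [Finset.mem_filter, Finset.mem_insert, Finset.mem_singleton, Finset.notMem_empty,
        iff_false, not_and]
      rintro (rfl | rfl)
      · exact lt_irrefl _
      · exact lt_asymm hab]
    simp
  have s2 : sign A ({a, b} : Finset (Fin (r + 1))) b = -1 := by
    rw [sign, show ({a, b} : Finset (Fin (r + 1))).filter (· < b) = {a} by
      ext i; simp only [Finset.mem_filter, Finset.mem_insert, Finset.mem_singleton]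
      constructor
      · rintro ⟨rfl | rfl, h⟩
        · rfl
        · exact absurd h (lt_irrefl _)
      · rintro rfl; exact ⟨Or.inl rfl, hab⟩]
    simp
  rw [faceQ_eq ι (edge a b hab) a (vertex b) h1 (Zop_mono ι (by simp)),
    faceQ_eq ι (edge a b hab) b (vertex a) h2 (Zop_mono ι (by simp)), s1, s2, one_smul, neg_one_smul, sub_eq_add_neg]

/-- **`dQ` on a triangle**: `(d c)_{a<b<e} = c_{be} - c_{ae} + c_{ab}` (restricted to `Z_{abe}`). [folklore] -/
theorem dQ_triangle (c : QX ι 1) (a b e : Fin (r + 1)) (hab : a < b) (hbe : b < e) :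
    dQ ι 1 c (triangle a b e hab hbe) =
      Sections.res (strZ ι) (Zop_mono ι (by simp [triangle, Finset.subset_iff])) (c (edge b e hbe)) -
        Sections.res (strZ ι) (Zop_mono ι (by simp [triangle, Finset.subset_iff])) (c (edge a e (hab.trans hbe))) +
          Sections.res (strZ ι) (Zop_mono ι (by simp [triangle, Finset.subset_iff])) (c (edge a b hab)) := by
  rw [dQ_apply]
  change ∑ x ∈ ({a, b, e} : Finset (Fin (r + 1))), sign A {a, b, e} x • faceQ ι 1 (triangle a b e hab hbe) x c = _
  have hnot : a ∉ ({b, e} : Finset (Fin (r + 1))) := by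
    simp only [Finset.mem_insert, Finset.mem_singleton, not_or]; exact ⟨hab.ne, (hab.trans hbe).ne⟩
  rw [Finset.sum_insert hnot, Finset.sum_pair hbe.ne, sign_triangle_left hab hbe, sign_triangle_mid hab hbe,
    sign_triangle_right hab hbe,
    faceQ_eq ι (triangle a b e hab hbe) a (edge b e hbe) (triangle_erase_left hab hbe)
      (Zop_mono ι (by simp [triangle, Finset.subset_iff])),
    faceQ_eq ι (triangle a b e hab hbe) b (edge a e (hab.trans hbe)) (triangle_erase_mid hab hbe)
      (Zop_mono ι (by simp [triangle, Finset.subset_iff])),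
    faceQ_eq ι (triangle a b e hab hbe) e (edge a b hab) (triangle_erase_right hab hbe)
      (Zop_mono ι (by simp [triangle, Finset.subset_iff]))]
  rw [one_smul, neg_one_smul, one_smul]
  abel

/-! ### From Čech cocycles of the tree (`CechH1`) to cocycles of `cechZ` -/

/-- The cover `Z_i = Z ∩ D₊(x_i)` of `Z`. [folklore] -/
abbrev cover (i : Fin (r + 1)) : Z.Opens := Zop ι {i}

/-- The smaller and the larger vertex of an edge. [folklore] -/
abbrev lo (σ : Simplex (Fin (r + 1)) 1) : Fin (r + 1) := σ.1.min' σ.2.1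

/-- See `lo`. [folklore] -/
abbrev hi (σ : Simplex (Fin (r + 1)) 1) : Fin (r + 1) := σ.1.max' σ.2.1

/-- `Z_σ ⊆ Z_{lo σ} ∩ Z_{hi σ}`. [folklore] -/
theorem Zop_le_cover_inf (σ : Simplex (Fin (r + 1)) 1) : Zop ι σ.1 ≤ cover ι (lo σ) ⊓ cover ι (hi σ) :=
  le_inf (Zop_mono ι (Finset.singleton_subset_iff.mpr (Finset.min'_mem _ _)))
    (Zop_mono ι (Finset.singleton_subset_iff.mpr (Finset.max'_mem _ _)))

/-- The vertices of an edge `{a < b}` are `a` and `b`. [folklore] -/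
theorem lo_edge (a b : Fin (r + 1)) (hab : a < b) : lo (edge a b hab) = a := by
  change ({a, b} : Finset (Fin (r + 1))).min' _ = a
  rw [Finset.min'_insert a {b} (Finset.singleton_nonempty b), Finset.min'_singleton, min_eq_left hab.le]

/-- See `lo_edge`. [folklore] -/
theorem hi_edge (a b : Fin (r + 1)) (hab : a < b) : hi (edge a b hab) = b := by
  change ({a, b} : Finset (Fin (r + 1))).max' _ = b
  rw [Finset.max'_insert a {b} (Finset.singleton_nonempty b), Finset.max'_singleton, max_eq_right hab.le]

/-- The value `c_{lo σ, hi σ}|_{Z_σ}` of a Čech `1`-cochain of the tree on the edge `σ`, a linear map.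
[folklore] -/
def edgeVal : CechC1 (strZ ι) (cover ι) →ₗ[A] QX ι 1 :=
  LinearMap.pi fun σ => (Sections.res (strZ ι) (Zop_le_cover_inf ι σ)).toLinearMap ∘ₗ
    (LinearMap.proj (hi σ) ∘ₗ LinearMap.proj (R := A)
      (φ := fun i => ∀ j, Sections (strZ ι) (cover ι i ⊓ cover ι j)) (lo σ))

/-- `edgeVal` unfolded. [folklore] -/
theorem edgeVal_apply (c : CechC1 (strZ ι) (cover ι)) (σ : Simplex (Fin (r + 1)) 1) :
    edgeVal ι c σ = Sections.res (strZ ι) (Zop_le_cover_inf ι σ) (c (lo σ) (hi σ)) := rfl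

/-- Transport of `edgeVal` along the identification of the vertices of an edge. [folklore] -/
theorem res_edgeVal_edge (c : CechC1 (strZ ι) (cover ι)) (a b : Fin (r + 1)) (hab : a < b) {V : Z.Opens}
    (h : V ≤ Zop ι (edge a b hab).1) :
    Sections.res (strZ ι) h (edgeVal ι c (edge a b hab)) =
      Sections.res (strZ ι) (h.trans ((Zop_le_cover_inf ι _).trans (by rw [lo_edge, hi_edge]))) (c a b) := by
  rw [edgeVal_apply, Sections.res_res]
  have key : ∀ (i j : Fin (r + 1)) (ei : i = a) (ej : j = b) (h₁ : V ≤ cover ι i ⊓ cover ι j)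
      (h₂ : V ≤ cover ι a ⊓ cover ι b), Sections.res (strZ ι) h₁ (c i j) = Sections.res (strZ ι) h₂ (c a b) := by
    intro i j ei ej; subst ei; subst ej; intro h₁ h₂; rfl
  exact key _ _ (lo_edge a b hab) (hi_edge a b hab) _ _

/-- **Cocycles go to cocycles**: for a Čech `1`-cocycle `c` of the tree, `dQ (edgeVal c) = 0`. [folklore] -/
theorem dQ_edgeVal_eq_zero {c : CechC1 (strZ ι) (cover ι)} (hc : c ∈ cechZ1 (strZ ι) (cover ι)) :
    dQ ι 1 (edgeVal ι c) = 0 := by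
  funext τ
  obtain ⟨a, b, e, hab, hbe, rfl⟩ := exists_eq_triangle τ
  rw [dQ_triangle]
  change _ = (0 : Sections (strZ ι) (Zop ι (triangle a b e hab hbe).1))
  rw [res_edgeVal_edge, res_edgeVal_edge, res_edgeVal_edge]
  have h3 : Zop ι (triangle a b e hab hbe).1 ≤ cover ι a ⊓ cover ι b ⊓ cover ι e :=
    le_inf (le_inf (Zop_mono ι (by simp [triangle, Finset.subset_iff]))
      (Zop_mono ι (by simp [triangle, Finset.subset_iff]))) (Zop_mono ι (by simp [triangle, Finset.subset_iff]))
  have key := congr_arg (Sections.res (strZ ι) h3) (congr_fun (congr_fun (congr_fun ((mem_cechZ1_iff _ _ c).mp hc) a) b) e)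
  rw [Pi.zero_apply, Pi.zero_apply, Pi.zero_apply, map_zero, cechD1_apply, map_add, map_sub, Sections.res_res,
    Sections.res_res, Sections.res_res] at key
  rw [← key]

/-- The map from the tree's Čech `1`-cocycles to the `1`-cocycles of `cechZ` (kernel of `dQ 1`). [folklore] -/
def toKer : cechZ1 (strZ ι) (cover ι) →ₗ[A] LinearMap.ker (dQ ι 1) :=
  LinearMap.codRestrict _ (edgeVal ι ∘ₗ (cechZ1 (strZ ι) (cover ι)).subtype) fun c => dQ_edgeVal_eq_zero ι c.2

/-- `toKer` unfolded. [folklore] -/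
theorem coe_toKer (c : cechZ1 (strZ ι) (cover ι)) : (toKer ι c : QX ι 1) = edgeVal ι c := rfl

/-- The `0`-cochain of `cechZ` attached to a `0`-cochain of the tree. [folklore] -/
def vertexVal : CechC0 (strZ ι) (cover ι) →ₗ[A] QX ι 0 :=
  LinearMap.pi fun σ => (Sections.res (strZ ι)
    (Zop_mono ι (Finset.singleton_subset_iff.mpr (Finset.min'_mem σ.1 σ.2.1)))).toLinearMap ∘ₗ
      LinearMap.proj (R := A) (φ := fun i => Sections (strZ ι) (cover ι i)) (σ.1.min' σ.2.1)

/-- `vertexVal` at a vertex `{i}`, restricted. [folklore] -/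
theorem res_vertexVal_vertex (g : CechC0 (strZ ι) (cover ι)) (i : Fin (r + 1)) {V : Z.Opens}
    (h : V ≤ Zop ι (vertex i).1) :
    Sections.res (strZ ι) h (vertexVal ι g (vertex i)) = Sections.res (strZ ι) h (g i) := by
  change Sections.res (strZ ι) h (Sections.res (strZ ι) _ (g ((vertex i).1.min' (vertex i).2.1))) = _
  rw [Sections.res_res]
  have key : ∀ (j : Fin (r + 1)) (ej : j = i) (h₁ : V ≤ cover ι j),
      Sections.res (strZ ι) h₁ (g j) = Sections.res (strZ ι) h (g i) := by
    intro j ej; subst ej; intro h₁; rfl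
  exact key _ (by change ({i} : Finset (Fin (r + 1))).min' _ = i; rw [Finset.min'_singleton]) _

/-- **Coboundaries go to coboundaries**: `edgeVal (d⁰ g) = dQ (vertexVal g)`. [folklore] -/
theorem edgeVal_cechD0 (g : CechC0 (strZ ι) (cover ι)) : edgeVal ι (cechD0 (strZ ι) (cover ι) g) = dQ ι 0 (vertexVal ι g) := by
  funext σ
  obtain ⟨a, b, hab, rfl⟩ := exists_eq_edge σ
  rw [dQ_edge, res_vertexVal_vertex, res_vertexVal_vertex]
  have := res_edgeVal_edge ι (cechD0 (strZ ι) (cover ι) g) a b hab le_rfl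
  rw [Sections.res_self] at this
  rw [this, cechD0_apply, map_sub, Sections.res_res, Sections.res_res]
  rfl

/-! ### Injectivity on cohomology and the finiteness of `Ȟ¹(𝒰, 𝒪_Z)` -/

/-- Restriction between opens which are equal (each contained in the other) is injective. [folklore] -/
theorem res_injective_of_le {V W : Z.Opens} (h : W ≤ V) (h' : V ≤ W) :
    Function.Injective (Sections.res (strZ ι) h) := by
  obtain rfl : W = V := le_antisymm h h'
  intro a b hab
  rwa [Sections.res_self, Sections.res_self] at hab

/-- `Z_{{a,b}} = Z_a ∩ Z_b` contains `Z_a ∩ Z_b` (`D₊(x_a x_b) = D₊(x_a) ∩ D₊(x_b)`). [folklore] -/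
theorem cover_inf_le_Zop_pair (a b : Fin (r + 1)) (hab : a ≠ b) :
    cover ι a ⊓ cover ι b ≤ Zop ι {a, b} := by
  have hx : Xs A ({a, b} : Finset (Fin (r + 1))) = Xs A {a} * Xs A {b} := by
    rw [← Xs_union (Finset.disjoint_singleton.mpr hab)]; rfl
  change ι ⁻¹ᵁ Dplus A r {a} ⊓ ι ⁻¹ᵁ Dplus A r {b} ≤ ι ⁻¹ᵁ Dplus A r {a, b}
  rw [← Scheme.Hom.preimage_inf, Dplus, Dplus, Dplus, hx, Proj.basicOpen_mul]

/-- The diagonal values of a Čech `1`-cocycle (all ordered pairs) vanish: `c_{ii} = 0`. [folklore] -/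
theorem cocycle_diag {c : CechC1 (strZ ι) (cover ι)} (hc : c ∈ cechZ1 (strZ ι) (cover ι)) (i : Fin (r + 1)) :
    c i i = 0 := by
  have key := congr_fun (congr_fun (congr_fun ((mem_cechZ1_iff _ _ c).mp hc) i) i) i
  rw [cechD1_apply, Pi.zero_apply, Pi.zero_apply, Pi.zero_apply,
    Sections.res_eq_res _ _ (inf_le_left : cover ι i ⊓ cover ι i ⊓ cover ι i ≤ cover ι i ⊓ cover ι i) (c i i),
    Sections.res_eq_res _ (le_inf (inf_le_left.trans inf_le_left) inf_le_right)
      (inf_le_left : cover ι i ⊓ cover ι i ⊓ cover ι i ≤ cover ι i ⊓ cover ι i) (c i i),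
    sub_self, zero_add] at key
  exact res_injective_of_le ι inf_le_left (le_inf le_rfl inf_le_left) (by rw [key, map_zero])

/-- The values of a Čech `1`-cocycle (all ordered pairs) are antisymmetric, after restriction:
`c_{ij}| + c_{ji}| = 0` on `Z_j ∩ Z_i ∩ Z_j`. [folklore] -/
theorem cocycle_antisymm {c : CechC1 (strZ ι) (cover ι)} (hc : c ∈ cechZ1 (strZ ι) (cover ι)) (i j : Fin (r + 1)) :
    Sections.res (strZ ι) (le_inf (inf_le_left.trans inf_le_right) inf_le_right) (c i j) +
      Sections.res (strZ ι) (inf_le_left : cover ι j ⊓ cover ι i ⊓ cover ι j ≤ cover ι j ⊓ cover ι i) (c j i) = 0 := by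
  have key := congr_fun (congr_fun (congr_fun ((mem_cechZ1_iff _ _ c).mp hc) j) i) j
  rw [cechD1_apply, Pi.zero_apply, Pi.zero_apply, Pi.zero_apply, cocycle_diag ι hc j, map_zero, sub_zero] at key
  exact key

variable [IsClosedImmersion ι]

/-- The short complex `Q⁰ → Q¹ → Q²` of `cechZ` in degree `1`. [folklore] -/
abbrev sc1 : ShortComplex (ModuleCat.{u} A) := (cechZ ι).sc' 0 1 2

/-- The differentials of `sc1` are `dQ 0` and `dQ 1`. [folklore] -/
theorem sc1_f : (sc1 ι).f = ModuleCat.ofHom (dQ ι 0) := cechZ_d ι 0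

/-- See `sc1_f`. [folklore] -/
theorem sc1_g : (sc1 ι).g = ModuleCat.ofHom (dQ ι 1) := cechZ_d ι 1

/-- The tree's Čech `1`-cocycles mapped to the cycles of `sc1`. [folklore] -/
def toCycles1 : cechZ1 (strZ ι) (cover ι) →ₗ[A] LinearMap.ker (sc1 ι).g.hom :=
  LinearMap.codRestrict _ (edgeVal ι ∘ₗ (cechZ1 (strZ ι) (cover ι)).subtype) fun c => by
    rw [LinearMap.mem_ker, sc1_g]
    exact dQ_edgeVal_eq_zero ι c.2

/-- Coboundaries of the tree go to boundaries of `sc1`. [folklore] -/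
theorem comap_cechB1_le :
    (cechB1 (strZ ι) (cover ι)).comap (cechZ1 (strZ ι) (cover ι)).subtype ≤
      (LinearMap.range (sc1 ι).moduleCatToCycles).comap (toCycles1 ι) := by
  intro c hc
  obtain ⟨g, hg⟩ := (mem_cechB1_iff _ _ _).mp hc
  refine ⟨vertexVal ι g, Subtype.ext ?_⟩
  change (sc1 ι).f.hom (vertexVal ι g) = edgeVal ι c
  rw [sc1_f]
  change dQ ι 0 (vertexVal ι g) = edgeVal ι ((cechZ1 (strZ ι) (cover ι)).subtype c)
  rw [← hg, edgeVal_cechD0]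

/-- **The comparison map `Ȟ¹(𝒰, 𝒪_Z) → H¹(Č(𝒰, 𝒪_Z))`** from the tree's Čech `H¹` (all ordered pairs,
`Literature.AlgebraicGeometry.Morphisms.CechH1`) to the cohomology of the alternating complex `cechZ`
(concretely `ker d¹ / im d⁰`), `A`-linear. [folklore] -/
def compH1 : CechH1 (strZ ι) (cover ι) →ₗ[A]
    LinearMap.ker (sc1 ι).g.hom ⧸ LinearMap.range (sc1 ι).moduleCatToCycles :=
  Submodule.mapQ _ _ (toCycles1 ι) (comap_cechB1_le ι)

/-- **The comparison map `Ȟ¹(𝒰, 𝒪_Z) → H¹(Č(𝒰, 𝒪_Z))` is injective**: if the edge values of a cocycle `c`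
are `g_b| - g_a|` then `c = d⁰ g` (using `c_{ii} = 0`, antisymmetry, and the injectivity of restriction
along `Z_a ∩ Z_b = Z_{ab}`). [folklore] -/
theorem compH1_injective : Function.Injective (compH1 ι) := by
  rw [injective_iff_map_eq_zero]
  intro x hx
  obtain ⟨c, rfl⟩ := CechH1.mk_surjective _ _ x
  rw [CechH1.mk_eq_zero_iff, mem_cechB1_iff]
  change Submodule.mapQ _ _ (toCycles1 ι) (comap_cechB1_le ι) (Submodule.Quotient.mk c) = 0 at hx
  rw [Submodule.mapQ_apply, Submodule.Quotient.mk_eq_zero] at hx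
  obtain ⟨g', hg'⟩ := hx
  have hg : ∀ σ, dQ ι 0 g' σ = edgeVal ι (c : CechC1 (strZ ι) (cover ι)) σ := by
    intro σ
    have h1 := congr_arg Subtype.val hg'
    change (sc1 ι).f.hom g' = edgeVal ι (c : CechC1 (strZ ι) (cover ι)) at h1
    rw [sc1_f] at h1
    exact congr_fun h1 σ
  -- the candidate `0`-cochain
  refine ⟨fun i => g' (vertex i), ?_⟩
  -- the case `a < b`
  have hlt : ∀ a b (hab : a < b), cechD0 (strZ ι) (cover ι) (fun i => g' (vertex i)) a b = (c : CechC1 (strZ ι) (cover ι)) a b := by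
    intro a b hab
    have h2le : Zop ι ({a, b} : Finset (Fin (r + 1))) ≤ cover ι a ⊓ cover ι b :=
      le_inf (Zop_mono ι (by simp)) (Zop_mono ι (by simp))
    have hinj := res_injective_of_le ι (V := cover ι a ⊓ cover ι b) (W := Zop ι {a, b}) h2le
      (cover_inf_le_Zop_pair ι a b hab.ne)
    apply hinj
    have h2 := res_edgeVal_edge ι (c : CechC1 (strZ ι) (cover ι)) a b hab le_rfl
    rw [Sections.res_self, ← hg, dQ_edge] at h2
    rw [cechD0_apply, map_sub, Sections.res_res, Sections.res_res]
    exact h2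
  funext a b
  rcases lt_trichotomy a b with hab | rfl | hab
  · exact hlt a b hab
  · rw [cocycle_diag ι c.2 a, cechD0_apply]
    exact sub_eq_zero.mpr (Sections.res_eq_res _ _ _ _)
  · -- `b < a`: use antisymmetry and the previous case for `(b, a)`
    have hanti := cocycle_antisymm ι c.2 a b
    have hba := hlt b a hab
    apply res_injective_of_le ι (le_inf (inf_le_left.trans inf_le_right) inf_le_right :
      cover ι b ⊓ cover ι a ⊓ cover ι b ≤ cover ι a ⊓ cover ι b) (le_inf (le_inf inf_le_right inf_le_left) inf_le_right)
    rw [eq_neg_of_add_eq_zero_left hanti, ← hba, cechD0_apply, cechD0_apply, map_sub, map_sub, Sections.res_res,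
      Sections.res_res, Sections.res_res, Sections.res_res, neg_sub]

/-- **`H¹` of `cechZ` is finitely generated, concretely** (`ker d¹ / im d⁰`). [folklore] -/
theorem moduleFinite_kerModRange [IsNoetherianRing A] :
    Module.Finite A (LinearMap.ker (sc1 ι).g.hom ⧸ LinearMap.range (sc1 ι).moduleCatToCycles) := by
  haveI : Module.Finite A ((cechZ ι).homology 1) := moduleFinite_homology_cechZ ι 1 le_rfl
  have e : (cechZ ι).homology 1 ≅ (sc1 ι).moduleCatLeftHomologyData.H :=
    (cechZ ι).homologyIsoSc' 0 1 2 (by simp) (by simp) ≪≫ (sc1 ι).moduleCatHomologyIso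
  haveI : Module.Finite A (sc1 ι).moduleCatLeftHomologyData.H := Module.Finite.equiv e.toLinearEquiv
  rwa [ShortComplex.moduleCatLeftHomologyData_H] at this

/-- **`Ȟ¹(𝒰, 𝒪_Z)` is a finitely generated `A`-module** for a closed subscheme `ι : Z ↪ 𝐏^r_A` over a
Noetherian ring `A` and the cover `𝒰 = (Z ∩ D₊(x_i))_i` (Hartshorne III Thm. 5.2 (a) for `𝒪_Z`, `i = 1`,
with `H¹` computed as the Čech cohomology of the standard affine cover, Thm. III.4.5): the tree's
`CechH1` embeds `A`-linearly into `H¹` of the alternating Čech complex `cechZ` (`compH1_injective`),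
which is finitely generated by Serre's theorem (`moduleFinite_homology_cechZ`).
[cite: Hartshorne1977, III Thm. 5.2 (a) p. 228 (PDF p. 284)] -/
theorem moduleFinite_cechH1 [IsNoetherianRing A] : Module.Finite A (CechH1 (strZ ι) (cover ι)) := by
  haveI := moduleFinite_kerModRange ι
  haveI : IsNoetherian A (LinearMap.ker (sc1 ι).g.hom ⧸ LinearMap.range (sc1 ι).moduleCatToCycles) :=
    isNoetherian_of_isNoetherianRing_of_finite A _
  exact Module.Finite.of_injective (compH1 ι) (compH1_injective ι)

omit [IsClosedImmersion ι] in
/-- The members `Z ∩ D₊(x_i)` of the cover are affine opens when `ι` is affine (e.g. a closed immersion).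
[folklore] -/
theorem isAffineOpen_cover [IsAffineHom ι] (i : Fin (r + 1)) : IsAffineOpen (cover ι i) :=
  (Proj.isAffineOpen_basicOpen _ _ (Xs_mem {i}) (by rw [Finset.card_singleton]; exact one_pos)).preimage ι

omit [IsClosedImmersion ι] in
/-- The cover `(Z ∩ D₊(x_i))_i` covers `Z`. [folklore] -/
theorem iSup_cover_eq_top : ⨆ i, cover ι i = ⊤ := by
  have h : ⨆ i : Fin (r + 1), Dplus A r {i} = ⊤ := by
    have := Proj.iSup_basicOpen_eq_top (grading A r) (fun i : Fin (r + 1) => MvPolynomial.X (R := A) i)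
      (Motives.Segre.irrelevant_le_span_X (Fin (r + 1)) A)
    have h' : (fun i : Fin (r + 1) => Proj.basicOpen (grading A r) (MvPolynomial.X (R := A) i)) =
        fun i => Dplus A r {i} := by
      funext i
      change _ = Proj.basicOpen (grading A r) (Xs A {i})
      rw [Xs_singleton]
    rw [h'] at this
    exact this
  change ⨆ i, ι ⁻¹ᵁ Dplus A r {i} = ⊤
  rw [← Scheme.Hom.preimage_iSup, h, Scheme.Hom.preimage_top]

end ProjCech

end Literature.AlgebraicGeometry.Morphisms
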